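import Summits.QuantumFields.YangMills.Theses.UnitScaleTilt
import Summits.QuantumFields.YangMills.Theorems.UnitScaleTiltFluctuationComparisonRegPrIntLChiV4
import HarnessLib

/-
# SKELETON v5kD — crux `FluctuationComparisonRegPrIntL` (route `UnitScaleTilt`, item stmt-QuantumFields-20520, DECIDING) — THE VERSION-4 SUCCESSOR OF v5kC (3aa24e4fa8fcb956;
# ★★OWNER RULING g26-№14 (F-2): the v3 (α) record's comb (67)-row `hLF67` at margin 0 LOCATED unsuppliable by print's map at the frozen selection — 19936 evidence #60 — and
# replaced ADDITIVELY by the currency-free (71)-row per recorded plaquette: `AlphaV4AC.RunAlphaV4ChiAC`, `AlphaInputsT3ACv4Chi` ★alpha-2 g7 ✓p615034∕✓p615341).  = v5kC with the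
# ONE-TOKEN v4 successor stubs `AlphaInputsT3ACv3RecChi ↦ AlphaInputsT3ACv4RecChi` (2′χ(v4) — SHARED byte-for-byte with 19936's v5p10 `stub_laneRecordsV4Chi`), `OfV3ChiAt ↦ OfV4ChiAt`,
# `PkgAtV3Chi ↦ PkgAtV4Chi`, `dataOfV3chi ↦ dataOfV4chi` (3⁗χ(v4), (i*)χ(v4)); STUB 1 and T8 verbatim.  §2 = ONE LINE through the v4 twin of ★r1 g3's record-free engine door
# `InteriorExcision.regPrIntL_of_v4ChiStubs` (`Theorems/UnitScaleTiltFluctuationComparisonRegPrIntLChiV4.lean`, width seat ym-ust-20520-w2 g4; v3 door p570604 unchanged in the tree).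
# Pen: ym-ust-20520-w2 g4 (20520 crux-writer); registered only on ★★OWNER GO.  YM₃ on T³ is rung R3 of the programme, not the Clay problem.
-/
noncomputable section

namespace Summit.QuantumFields.YangMills.Cruxes.FluctuationComparisonRegPrIntL.BirthV5kD

open MeasureTheory Filter Topology
open Literature.MathematicalPhysics.QuantumFieldTheory.Balaban1983to89
open Literature.MathematicalPhysics.QuantumFieldTheory.Balaban1983to89.T3ContinuumYM3Torus
open Literature.MathematicalPhysics.QuantumFieldTheory.Balaban1983to89.T3UnitLawDensityEML (ℰp measurableE_ℰp)
open Literature.MathematicalPhysics.QuantumFieldTheory.Balaban1983to89.T3UnitScaleTilt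
open Literature.MathematicalPhysics.QuantumFieldTheory.Balaban1983to89.T3SmallLiftHistory
open Literature.MathematicalPhysics.QuantumFieldTheory.Balaban1983to89.T3PrintedMinimiserExistence
open Literature.MathematicalPhysics.QuantumFieldTheory.Balaban1983to89.T3LowerAlongMinimisersSplit (MinimisersIn8At)
open Summit.QuantumFields.YangMills.Theorems.PrintChi
open Summit.QuantumFields.YangMills.Theorems.GlobalSlack

/-! ## §1 Registered stubs (sorries live ONLY here) -/

/-- STUB 1 (statement v5h/v5j‴/v5k verbatim; CLOSED in the tree by name — p490827 `Theorems.ApproxLift.AnsatzT.stub_oneStepSmallLift`). [cite: Balaban1987RG1, (0.4) p.253, p.254 (small-field regions, Ū = V) and (0.16) p.255] -/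
theorem stub_oneStepSmallLift :
    ∀ L : ℕ, ∃ κ δ₀ : ℝ, κ * Real.sqrt L ≤ 1 ∧ 0 < δ₀ ∧
      ∀ F : T3Family, F.L = L → OneStepSmallLift F ℰp κ δ₀ := by
  sorry

/-- STUB 2′χ(v4) — the version-4 (α) record with print's lower row and the currency-free (71)-row: `AlphaInputsT3ACv4RecChi L` by name (= 19936 v5p10's `stub_laneRecordsV4Chi`, byte-for-byte). [cite: Balaban1985UV3, Thm 1 p.257, (7) p.257, (47) p.267, (55) p.269, (71) p.273 and Thm 2 p.272] -/
theorem stub_laneRecordsV4Chi : ∀ L : ℕ, Odd L → 1 < L → Summit.QuantumFields.YangMills.Theorems.AlphaInputsT3ACv4RecChi L := by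
  sorry

/-- STUB 3⁗χ(v4) — v5kC's 3⁗χ over the version-4 χ-package family and its datum `dataOfV4chi`. [cite: King1986, Thm 3.4 (3.9) p.656; Balaban1985UV3, (43)-(46) pp.266-267 and (57) p.270] -/
theorem stub_globalTwoRunSlackFamChiV4 :
    ∀ (L : ℕ), Odd L → 7 ≤ L → ∀ (𝔠 : Summit.QuantumFields.Balaban3D.Proofs.Primitives.AlphaConsts L (Summit.QuantumFields.Balaban3D.Carriers.suGroupModel 2).N)
      (a₀ a₁ : ℝ), 0 < a₀ → 0 < a₁ → 𝔠.B₃ * a₁ ≤ a₀ →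
      ∃ a : ℝ, 0 < a ∧ ∃ γB : ℝ, 0 < γB ∧ ∀ (F : T3Family) (γ : ℝ) (hF : F.L = L) (hγ : 0 < γ), γ ≤ γB →
        ∀ (hγ1 : γ ≤ (min (hF ▸ 𝔠).gamma0 1) ^ 2),
          Summit.QuantumFields.YangMills.Theorems.AlphaInputsT3AC.OfV4ChiAt F (hF ▸ 𝔠) a₀ a₁ →
          ∃ (p : ∀ K, Summit.QuantumFields.YangMills.Theorems.AlphaInputsT3AC.PkgAtV4Chi F (hF ▸ 𝔠) γ hγ hγ1 K),
            (∀ K, (p K).a₀ = a₀ ∧ (p K).a₁ = a₁) ∧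
            ∃ (π : Summit.QuantumFields.YangMills.Theorems.AlphaInputsT3AC.PolymerT3 F) (σ : ℕ) (C : ℝ), 7 ≤ σ ∧ 0 ≤ C ∧
              Summit.QuantumFields.YangMills.Theorems.GlobalSlack.GlobalSupRateTSlack (Summit.QuantumFields.YangMills.Theorems.AlphaInputsT3AC.dataOfV4chi p π) (hF ▸ 𝔠).b₀ (hF ▸ 𝔠).p₀ a σ C := by
  sorry

/-- STUB (i*)χ(v4) — v5kC's (i*)χ over the version-4 χ-package family and its datum `dataOfV4chi`. [cite: King1986, Thm 3.4 (3.9) p.656] -/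
theorem stub_smallBlocksSlackOnChiAllChiV4 :
    ∀ (L : ℕ), Odd L → 1 < L → L < 7 → ∀ (μ : ℝ), 0 < μ → μ < 1 →
      ∀ (𝔠 : Summit.QuantumFields.Balaban3D.Proofs.Primitives.AlphaConsts L (Summit.QuantumFields.Balaban3D.Carriers.suGroupModel 2).N)
        (a₀ a₁ : ℝ), 0 < a₀ → 0 < a₁ → 𝔠.B₃ * a₁ ≤ a₀ →
        ∃ a : ℝ, 0 < a ∧ ∃ γB : ℝ, 0 < γB ∧ ∀ (F : T3Family) (γ : ℝ) (hF : F.L = L) (hγ : 0 < γ), γ ≤ γB →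
          ∀ (hγ1 : γ ≤ (min (hF ▸ 𝔠).gamma0 1) ^ 2),
            Summit.QuantumFields.YangMills.Theorems.AlphaInputsT3AC.OfV4ChiAt F (hF ▸ 𝔠) a₀ a₁ →
            ∃ (p : ∀ K, Summit.QuantumFields.YangMills.Theorems.AlphaInputsT3AC.PkgAtV4Chi F (hF ▸ 𝔠) γ hγ hγ1 K),
              (∀ K, (p K).a₀ = a₀ ∧ (p K).a₁ = a₁) ∧
              ∃ (π : Summit.QuantumFields.YangMills.Theorems.AlphaInputsT3AC.PolymerT3 F) (σ : ℕ) (C : ℝ), 7 ≤ σ ∧ 0 ≤ C ∧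
                ∀ ε₀ : ℝ, 0 < ε₀ → ε₀ ≤ a₀ →
                  GlobalSupRateTSlackOn (fun K n h V => ChiGood F γ (hF ▸ 𝔠).b₀ (hF ▸ 𝔠).p₀ ε₀ μ (n := n) (K := K) h V)
                    (Summit.QuantumFields.YangMills.Theorems.AlphaInputsT3AC.dataOfV4chi p π) (hF ▸ 𝔠).b₀ (hF ▸ 𝔠).p₀ a σ C := by
  sorry

/-- STUB T8 (OWNER RULING g23-№2 ADD. 7) — [Balaban1985Variational] Thm 1 (global reading) ∧ its (8)-clause for EVERY minimiser, at every odd block size; closes BY NAME from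
19200's `variational_of_leaves_log` via `InteriorExcision.thm1In8_of_attained_of_in8`. [cite: Balaban1985Variational, Thm 1 (8) p.279, Prop 7 p.299 and Prop 8 p.304] -/
theorem stub_thm1In8GlobalMin : ∀ L : ℕ, Odd L → 1 < L → ∃ a₀ a₁ B₃ : ℝ, 0 < a₀ ∧ 0 < a₁ ∧ 0 < B₃ ∧
    Thm1GlobalMinAt L a₀ a₁ B₃ ∧ MinimisersIn8At L a₀ a₁ B₃ := by
  sorry

/-! ## §2 The composition — NO sorry below this line -/

/-- **`FluctuationComparisonRegPrIntL ⇐ STUB 1 ∧ T8 ∧ 2′χ(v4) ∧ 3⁗χ(v4) ∧ (i*)χ(v4)`** BY NAME through the v4 twin of ★r1 g3's record-free engine door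
(`InteriorExcision.regPrIntL_of_v4ChiStubs`; the Literature Prop and the route decl unfold to the same term). -/
theorem FluctuationComparisonRegPrIntL_of : Summit.QuantumFields.YangMills.Theses.UnitScaleTilt.FluctuationComparisonRegPrIntL :=
  Summit.QuantumFields.YangMills.Theorems.InteriorExcision.regPrIntL_of_v4ChiStubs stub_oneStepSmallLift stub_thm1In8GlobalMin
    stub_laneRecordsV4Chi stub_globalTwoRunSlackFamChiV4 stub_smallBlocksSlackOnChiAllChiV4

end Summit.QuantumFields.YangMills.Cruxes.FluctuationComparisonRegPrIntL.BirthV5kD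

end
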